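import Literature.Computability.AlgebraicComplexity.SymmetricDetCircuit
import Mathlib.Tactic.Ring
import HarnessLib

/-!
# Le Verrier's symmetric circuit for the determinant (Dawar–Wilsenach, Theorem 4.1): size and correctness

Topic `Computability/AlgebraicComplexity`; continues `SymmetricDetCircuit.lean` (the circuit
`leVerrierCircuit K n` on the gates `LeVerrierGate n`, `Sym_n`-symmetric by
`isSymmetric_leVerrierCircuit`). Here:

* **size** — `card_leVerrierGate : |LeVerrierGate n| = n⁴ + 2n³ + n² + 3n + 2 ≤ (n + 2)⁴`
  (`card_leVerrierGate_le`, `size_leVerrierCircuit`);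
* **correctness** — `eval_output_leVerrierCircuit`: the output evaluates to the generic determinant
  `detPoly (Fin n) K`. The invariant (`leVerrierCircuit.eval_nmat`, downward induction on the level)
  is that the gate `N_l(i,j)` evaluates to the entry `flMat (−X) l i j` of the Faddeev–LeVerrier
  matrix of `M = −X = leVerrierMatrix K n` (`Literature/LinearAlgebra/Matrix/FaddeevLeVerrier.lean`: `N_{n-1} = 1`,
  `N_{l-1} = M N_l + c_l 1`, `(n − l) c_l = −tr(M N_l)` — the exact division is where characteristic
  `0` enters — and `c_0 = det(−M) = det X`);
* **Dawar–Wilsenach Thm. 4.1, existence form** — `exists_isSymmetric_circuit_detPoly`: for every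
  `n`, `det (x_ij)` has an `S_n`-symmetric labelled circuit with `≤ (n + 2)⁴` gates over any field of
  characteristic `0`.

A. Dawar, G. Wilsenach, *Symmetric Arithmetic Circuits*, Theory of Computing 21 (14) (2025), Thm. 4.1
(Le Verrier's method). Everything is proved.
-/

noncomputable section

namespace Literature.Computability.AlgebraicComplexity

open MvPolynomial

universe u

/-! ### Size -/

/-- **Size of Le Verrier's circuit**: `n⁴ + 2n³ + n² + 3n + 2` gates (via the evident equivalence
with a sum of products of `Fin n`). [cite: DawarWilsenach2025, Thm. 4.1] -/
theorem card_leVerrierGate (n : ℕ) :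
    Fintype.card (LeVerrierGate n) = n ^ 4 + 2 * n ^ 3 + n ^ 2 + 3 * n + 2 := by
  let e : LeVerrierGate n ≃ ((Fin n × Fin n) ⊕ Unit ⊕ Unit ⊕ Fin n) ⊕
      ((Fin n × Fin n × Fin n) ⊕ (Fin n × Fin n × Fin n × Fin n) ⊕ (Fin n × Fin n × Fin n) ⊕
        Fin n ⊕ Fin n) :=
    { toFun := fun g => match g with
        | .inp x => Sum.inl (Sum.inl x)
        | .zero => Sum.inl (Sum.inr (Sum.inl ()))
        | .one => Sum.inl (Sum.inr (Sum.inr (Sum.inl ())))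
        | .cst l => Sum.inl (Sum.inr (Sum.inr (Sum.inr l)))
        | .nmat l i j => Sum.inr (Sum.inl (l, i, j))
        | .prd l i k j => Sum.inr (Sum.inr (Sum.inl (l, i, k, j)))
        | .xn l i j => Sum.inr (Sum.inr (Sum.inr (Sum.inl (l, i, j))))
        | .tr l => Sum.inr (Sum.inr (Sum.inr (Sum.inr (Sum.inl l))))
        | .coef l => Sum.inr (Sum.inr (Sum.inr (Sum.inr (Sum.inr l))))
      invFun := fun s => match s with
        | Sum.inl (Sum.inl x) => .inp x
        | Sum.inl (Sum.inr (Sum.inl _)) => .zero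
        | Sum.inl (Sum.inr (Sum.inr (Sum.inl _))) => .one
        | Sum.inl (Sum.inr (Sum.inr (Sum.inr l))) => .cst l
        | Sum.inr (Sum.inl (l, i, j)) => .nmat l i j
        | Sum.inr (Sum.inr (Sum.inl (l, i, k, j))) => .prd l i k j
        | Sum.inr (Sum.inr (Sum.inr (Sum.inl (l, i, j)))) => .xn l i j
        | Sum.inr (Sum.inr (Sum.inr (Sum.inr (Sum.inl l)))) => .tr l
        | Sum.inr (Sum.inr (Sum.inr (Sum.inr (Sum.inr l)))) => .coef l
      left_inv := fun g => by cases g <;> rfl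
      right_inv := fun s => by
        rcases s with (x | ⟨⟨⟩⟩ | ⟨⟨⟩⟩ | l) | (⟨l, i, j⟩ | ⟨l, i, k, j⟩ | ⟨l, i, j⟩ | l | l) <;> rfl }
  rw [Fintype.card_congr e]
  simp only [Fintype.card_sum, Fintype.card_prod, Fintype.card_fin, Fintype.card_unit]
  ring

/-- The size is at most `(n + 2)⁴`. [folklore] -/
theorem card_leVerrierGate_le (n : ℕ) : Fintype.card (LeVerrierGate n) ≤ (n + 2) ^ 4 := by
  rw [card_leVerrierGate]
  calc n ^ 4 + 2 * n ^ 3 + n ^ 2 + 3 * n + 2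
      ≤ n ^ 4 + 2 * n ^ 3 + n ^ 2 + 3 * n + 2 + (6 * n ^ 3 + 23 * n ^ 2 + 29 * n + 14) :=
        Nat.le_add_right _ _
    _ = (n + 2) ^ 4 := by ring

/-- The size of Le Verrier's circuit (as `LabelledArithCircuit.size`). [cite: DawarWilsenach2025, Thm. 4.1] -/
theorem size_leVerrierCircuit (K : Type u) [Field K] [CharZero K] (n : ℕ) :
    (leVerrierCircuit K n).size = n ^ 4 + 2 * n ^ 3 + n ^ 2 + 3 * n + 2 :=
  card_leVerrierGate n

/-! ### Correctness: the circuit computes the determinant -/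

section Eval

open LeVerrierGate Literature.LinearAlgebra.Matrix

namespace leVerrierCircuit

variable (K : Type u) [Field K] [CharZero K] {n : ℕ}

/-- Input gates evaluate to the variables. [folklore] -/
theorem eval_inp (x : Fin n × Fin n) : (leVerrierCircuit K n).eval (inp x) = MvPolynomial.X x :=
  (leVerrierCircuit K n).eval_of_label_var rfl

/-- The gate `0` evaluates to `0`. [folklore] -/
theorem eval_zero : (leVerrierCircuit K n).eval zero = 0 := by
  rw [(leVerrierCircuit K n).eval_of_label_const (c := 0) rfl, map_zero]

/-- The gate `1` evaluates to `1`. [folklore] -/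
theorem eval_one : (leVerrierCircuit K n).eval one = 1 := by
  rw [(leVerrierCircuit K n).eval_of_label_const (c := 1) rfl, map_one]

/-- The constant gates evaluate to `κ_l = −1/(n − l)`. [folklore] -/
theorem eval_cst (l : Fin n) :
    (leVerrierCircuit K n).eval (cst l) = MvPolynomial.C (-((n - l : ℕ) : K)⁻¹) :=
  (leVerrierCircuit K n).eval_of_label_const rfl

/-- The product gates: `P_l(i,k,j) = −x_ik · N_l(k,j)`. [folklore] -/
theorem eval_prd (l i k j : Fin n) :
    (leVerrierCircuit K n).eval (prd l i k j) =
      -(MvPolynomial.X (i, k) * (leVerrierCircuit K n).eval (nmat l k j)) := by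
  rw [(leVerrierCircuit K n).eval_of_label_mul rfl,
    show (leVerrierCircuit K n).children (prd l i k j) = {cst (top l), inp (i, k), nmat l k j} from rfl,
    Finset.prod_insert (by simp), Finset.prod_pair (by simp), eval_cst, eval_inp]
  have h1 : ((n - (top l : ℕ) : ℕ) : K) = 1 := by
    have := l.isLt
    rw [top_val, show n - (n - 1) = 1 by omega, Nat.cast_one]
  rw [h1, inv_one, map_neg, map_one, neg_one_mul]

/-- The entries `(M N_l)(i,j) = ∑_k P_l(i,k,j)`. [folklore] -/
theorem eval_xn (l i j : Fin n) :
    (leVerrierCircuit K n).eval (xn l i j) = ∑ k, (leVerrierCircuit K n).eval (prd l i k j) := by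
  rw [(leVerrierCircuit K n).eval_of_label_add rfl,
    show (leVerrierCircuit K n).children (xn l i j) = Finset.univ.image fun k => prd l i k j from rfl,
    Finset.sum_image (fun k _ k' _ h => by simpa using h)]

/-- The traces `t_l = ∑_i (M N_l)(i,i)`. [folklore] -/
theorem eval_tr (l : Fin n) :
    (leVerrierCircuit K n).eval (tr l) = ∑ i, (leVerrierCircuit K n).eval (xn l i i) := by
  rw [(leVerrierCircuit K n).eval_of_label_add rfl,
    show (leVerrierCircuit K n).children (tr l) = Finset.univ.image fun i => xn l i i from rfl,
    Finset.sum_image (fun i _ i' _ h => by simpa using h)]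

/-- The coefficients `c_l = κ_l · t_l`. [folklore] -/
theorem eval_coef (l : Fin n) :
    (leVerrierCircuit K n).eval (coef l) =
      MvPolynomial.C (-((n - l : ℕ) : K)⁻¹) * (leVerrierCircuit K n).eval (tr l) := by
  rw [(leVerrierCircuit K n).eval_of_label_mul rfl,
    show (leVerrierCircuit K n).children (coef l) = {cst l, tr l} from rfl,
    Finset.prod_pair (by simp), eval_cst]

/-- The top level: `N_{n-1}(i,j) = [i = j]`. [folklore] -/
theorem eval_nmat_top {l : Fin n} (hl : (l : ℕ) + 1 = n) (i j : Fin n) :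
    (leVerrierCircuit K n).eval (nmat l i j) = if i = j then 1 else 0 := by
  rw [(leVerrierCircuit K n).eval_of_label_add rfl]
  have hc : (leVerrierCircuit K n).children (nmat l i j) = if i = j then {one} else {zero} := by
    show children (nmat l i j) = _
    rw [children, dif_neg (by omega)]
  rw [hc]
  split_ifs
  · rw [Finset.sum_singleton, eval_one]
  · rw [Finset.sum_singleton, eval_zero]

/-- The recursion level: `N_l(i,j) = (M N_{l+1})(i,j) + [i = j] c_{l+1}` for `l + 1 < n`. [folklore] -/
theorem eval_nmat_step {l : Fin n} (hl : (l : ℕ) + 1 < n) (i j : Fin n) :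
    (leVerrierCircuit K n).eval (nmat l i j) =
      (leVerrierCircuit K n).eval (xn ⟨l + 1, hl⟩ i j) +
        if i = j then (leVerrierCircuit K n).eval (coef ⟨l + 1, hl⟩) else 0 := by
  rw [(leVerrierCircuit K n).eval_of_label_add rfl]
  have hc : (leVerrierCircuit K n).children (nmat l i j) =
      insert (xn ⟨l + 1, hl⟩ i j) (if i = j then {coef ⟨l + 1, hl⟩} else ∅) := by
    show children (nmat l i j) = _
    rw [children, dif_pos hl]
  rw [hc]
  by_cases hij : i = j
  · rw [if_pos hij, if_pos hij, Finset.sum_pair (by simp)]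
  · rw [if_neg hij, if_neg hij, Finset.insert_empty, Finset.sum_singleton, add_zero]

/-- From the entries `N_l` to the entries of `M N_l`. [folklore] -/
theorem eval_xn_of (l : Fin n)
    (h : ∀ i j, (leVerrierCircuit K n).eval (nmat l i j) = flMat (leVerrierMatrix K n) l i j)
    (i j : Fin n) :
    (leVerrierCircuit K n).eval (xn l i j) = (leVerrierMatrix K n * flMat (leVerrierMatrix K n) l) i j := by
  rw [eval_xn, Matrix.mul_apply]
  refine Finset.sum_congr rfl fun k _ => ?_
  rw [eval_prd, h, leVerrierMatrix_apply, neg_mul]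

/-- From the entries `N_l` to the trace `tr(M N_l)`. [folklore] -/
theorem eval_tr_of (l : Fin n)
    (h : ∀ i j, (leVerrierCircuit K n).eval (nmat l i j) = flMat (leVerrierMatrix K n) l i j) :
    (leVerrierCircuit K n).eval (tr l) = (leVerrierMatrix K n * flMat (leVerrierMatrix K n) l).trace := by
  rw [eval_tr, Matrix.trace]
  exact Finset.sum_congr rfl fun i _ => eval_xn_of K l h i i

/-- From the entries `N_l` to the coefficient `c_l` (the exact division by `n − l`:
`(n − l) c_l = −tr(M N_l)`, `sub_mul_charpoly_coeff`). [cite: DawarWilsenach2025, Thm. 4.1] -/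
theorem eval_coef_of (l : Fin n)
    (h : ∀ i j, (leVerrierCircuit K n).eval (nmat l i j) = flMat (leVerrierMatrix K n) l i j) :
    (leVerrierCircuit K n).eval (coef l) = (leVerrierMatrix K n).charpoly.coeff l := by
  rw [eval_coef, eval_tr_of K l h]
  have key := sub_mul_charpoly_coeff (leVerrierMatrix K n) (l := l) (by simp)
  rw [Fintype.card_fin] at key
  have hne : ((n - l : ℕ) : K) ≠ 0 := by
    have := l.isLt
    exact Nat.cast_ne_zero.2 (by omega)
  have htr : (leVerrierMatrix K n * flMat (leVerrierMatrix K n) l).trace =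
      -(MvPolynomial.C ((n - l : ℕ) : K) * (leVerrierMatrix K n).charpoly.coeff l) := by
    rw [map_natCast, key, neg_neg]
  rw [htr, map_neg, neg_mul_neg, ← mul_assoc, ← map_mul, inv_mul_cancel₀ hne, map_one, one_mul]

/-- **The invariant of the recursion**: the gate `N_l(i,j)` evaluates to the `(i,j)` entry of the
Faddeev–LeVerrier matrix `flMat (−X) l` (downward induction on `l`, from `N_{n-1} = 1` and
`N_l = M N_{l+1} + c_{l+1} 1`). [cite: DawarWilsenach2025, Thm. 4.1] -/
theorem eval_nmat (l i j : Fin n) :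
    (leVerrierCircuit K n).eval (nmat l i j) = flMat (leVerrierMatrix K n) l i j := by
  suffices H : ∀ (d : ℕ) (l : Fin n), (l : ℕ) + d + 1 = n →
      ∀ i j, (leVerrierCircuit K n).eval (nmat l i j) = flMat (leVerrierMatrix K n) l i j by
    have := l.isLt
    exact H (n - 1 - l) l (by omega) i j
  intro d
  induction d with
  | zero =>
    intro l hl i j
    haveI : Nonempty (Fin n) := ⟨l⟩
    rw [eval_nmat_top K (by omega), show (l : ℕ) = Fintype.card (Fin n) - 1 by simp; omega,
      flMat_card_sub_one, Matrix.one_apply]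
  | succ d ih =>
    intro l hl i j
    have hl' : (l : ℕ) + 1 < n := by omega
    have IH := ih ⟨l + 1, hl'⟩ (by simp; omega)
    rw [eval_nmat_step K hl', eval_xn_of K _ IH, flMat_eq_mul_add (leVerrierMatrix K n) l,
      Matrix.add_apply, Matrix.smul_apply, Matrix.one_apply, smul_eq_mul, mul_ite, mul_one, mul_zero]
    congr 1
    split_ifs
    · rw [eval_coef_of K _ IH]
    · rfl

end leVerrierCircuit

/-- **Le Verrier's circuit computes the determinant**: its output evaluates to the generic
determinant `detPoly (Fin n) K = det (x_ij)` (for `n ≥ 1`: `c_0(−X) = det(−(−X)) = det X`; for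
`n = 0`: `1`). [cite: DawarWilsenach2025, Thm. 4.1] -/
theorem eval_output_leVerrierCircuit (K : Type u) [Field K] [CharZero K] (n : ℕ) :
    (leVerrierCircuit K n).eval ((leVerrierCircuit K n).output ()) = detPoly (Fin n) K := by
  change (leVerrierCircuit K n).eval (if h : 0 < n then coef ⟨0, h⟩ else one) = _
  split_ifs with h
  · rw [leVerrierCircuit.eval_coef_of K _ (leVerrierCircuit.eval_nmat K _),
      show (((⟨0, h⟩ : Fin n) : ℕ)) = 0 from rfl, charpoly_coeff_zero_eq_det_neg, leVerrierMatrix,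
      neg_neg]
    rfl
  · have hn : n = 0 := by omega
    subst hn
    rw [leVerrierCircuit.eval_one, detPoly, Matrix.det_isEmpty]

/-- **Dawar–Wilsenach, Theorem 4.1** (existence form, diagonal `Sym_n`): over a field of
characteristic `0`, for every `n` the generic determinant `det (x_ij)` is computed by an
`S_n`-symmetric labelled arithmetic circuit with at most `(n + 2)⁴` gates.
[cite: DawarWilsenach2025, Thm. 4.1] -/
theorem exists_isSymmetric_circuit_detPoly (K : Type u) [Field K] [CharZero K] (n : ℕ)
    [MulAction (Equiv.Perm (Fin n)) Unit] :
    ∃ (G : Type) (_ : Fintype G) (C : LabelledArithCircuit K (Fin n × Fin n) Unit G),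
      C.IsSymmetric (Equiv.Perm (Fin n)) ∧ C.eval (C.output ()) = detPoly (Fin n) K ∧
        Fintype.card G ≤ (n + 2) ^ 4 :=
  ⟨LeVerrierGate n, inferInstance, leVerrierCircuit K n, isSymmetric_leVerrierCircuit K n,
    eval_output_leVerrierCircuit K n, card_leVerrierGate_le n⟩

end Eval

end Literature.Computability.AlgebraicComplexity

end
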